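import Mathlib
import Summits.Ventures.PercRepro2.Chord

/-!
# (MIX-CHORD): the mixed chord of the covariance form along a root edge, and the crux from it
(blind cell PercRepro2, night-1 g19; proofs/NIGHT1-G19.md §1; namespace `Mix`)

Mine-a's row (EXISTS-CHORD) (`Chord.ExistsChord`, the chord of `Gloc = Gc / (D · Z)` along SOME
fractional root edge) is FALSE (NIGHT1-G19.md §0: a 7-vertex witness with both roots pendant on one
fractional edge each, where `Gc (p[e ↦ 0]) = 0` and the chord asks
`Gc p ≥ p_e · Gc (p[e ↦ 1]) · (D·Z)(p) / (D·Z)(p[e ↦ 1])` with a factor `≥ 1`).  The repair caps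
the open end's coefficient at `1` and keeps the closed end's shrinkage:

* `shrink p e = (D·Z)(p) / (D·Z)(p[e ↦ 0])` (`0` when the denominator vanishes);
* **`MixChord p`** (row (MIX-CHORD) at the weight vector `p`): along EVERY root edge `e`
  (a fractional edge touching the weight-`1` cluster of `a₁` or of `a₂`),
  `p_e · Gc (p[e ↦ 1]) + (1 − p_e) · shrink p e · Gc (p[e ↦ 0]) ≤ Gc p`
  (census 5,278 / 5,278 root edges, NIGHT1-G19.md §1; it also holds along every fractional edge at
  `a₃`, 1,993 / 1,993, and fails along other edges);
* **`Gc_nonneg_of_mixChord`**: strong induction on the number of fractional edges — both children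
  of a root edge have one fractional edge fewer and nonnegative `Gc`, the row makes `Gc p` a
  nonnegative combination; with no fractional root edge `Gc = 0` (`Chord.Gc_eq_zero_of_rootEdges_empty`);
* **`HCov_of_mixChord`** / **`HCov_all_of_mixChord_all`**: (MIX-CHORD) on all instances ⟹ the crux
  `CovForm.HCov_all`.

Own code; standard axioms.
-/

namespace Summit.Ventures.PercRepro2

open UnionCluster CovForm

namespace Mix

open scoped Classical

section Defs

variable {V : Type*} {E : Type*} [Fintype E] [DecidableEq E] {R : Type*} [Field R]
  [LinearOrder R]

/-- The shrinkage of the normaliser `D · Z` when the edge `e` is closed: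
`(D·Z)(p) / (D·Z)(p[e ↦ 0])` (`0` when the denominator vanishes, Lean's `x / 0 = 0`). -/
noncomputable def shrink (p : E → R) (ends : E → Sym2 V) (a₁ a₂ a₃ : V) (e : E) : R :=
  (prob p (PDEvent ends a₁ a₂ a₃) * prob p (avoidAll ends a₂ {a₁})) /
    (prob (Function.update p e 0) (PDEvent ends a₁ a₂ a₃) *
      prob (Function.update p e 0) (avoidAll ends a₂ {a₁}))

/-- **(MIX-CHORD)** at the weight vector `p`: along every root edge `e`,
`p_e · Gc (p[e ↦ 1]) + (1 − p_e) · shrink p e · Gc (p[e ↦ 0]) ≤ Gc p`. -/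
def MixChord (p : E → R) (ends : E → Sym2 V) (o a₁ a₂ a₃ b : V) : Prop :=
  ∀ e ∈ Chord.rootEdges p ends a₁ a₂,
    p e * Gc (Function.update p e 1) ends o a₁ a₂ a₃ b +
      (1 - p e) * (shrink p ends a₁ a₂ a₃ e * Gc (Function.update p e 0) ends o a₁ a₂ a₃ b) ≤
        Gc p ends o a₁ a₂ a₃ b

end Defs

section Closure

variable (R : Type*) [Field R] [LinearOrder R] [IsStrictOrderedRing R]

/-- Row (MIX-CHORD) over all finite graphs, admissible weights and markings. -/
def MixChord_all : Prop :=
  ∀ (V E : Type) [Fintype V] [DecidableEq V] [Fintype E] [DecidableEq E]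
    (ends : E → Sym2 V) (p : E → R), IsProbVec p →
    ∀ o a₁ a₂ a₃ b : V, a₁ ≠ a₂ → a₁ ≠ a₃ → a₂ ≠ a₃ → o ≠ a₁ → o ≠ a₂ → o ≠ a₃ → o ≠ b →
      b ≠ a₁ → b ≠ a₂ → b ≠ a₃ → MixChord p ends o a₁ a₂ a₃ b

end Closure

section Induction

variable {V : Type*} {E : Type*} [Fintype E] [DecidableEq E] {R : Type*} [Field R]
  [LinearOrder R] [IsStrictOrderedRing R]

/-- The shrinkage is nonnegative. -/
lemma shrink_nonneg {p : E → R} (hp : IsProbVec p) (ends : E → Sym2 V) (a₁ a₂ a₃ : V) (e : E) :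
    0 ≤ shrink p ends a₁ a₂ a₃ e := by
  have hp0 : IsProbVec (Function.update p e 0) := hp.update e le_rfl zero_le_one
  exact div_nonneg (mul_nonneg (prob_nonneg hp _) (prob_nonneg hp _))
    (mul_nonneg (prob_nonneg hp0 _) (prob_nonneg hp0 _))

/-- **(MIX-CHORD) ⟹ `Gc ≥ 0`**: strong induction on the number of fractional edges; the children
`p[e ↦ 1]`, `p[e ↦ 0]` of a root edge have one fractional edge fewer. -/
theorem Gc_nonneg_of_mixChord (ends : E → Sym2 V) (o a₁ a₂ a₃ b : V)
    (hmix : ∀ q : E → R, IsProbVec q → MixChord q ends o a₁ a₂ a₃ b) :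
    ∀ (n : ℕ) (p : E → R), IsProbVec p → (Chord.frac p).card = n →
      0 ≤ Gc p ends o a₁ a₂ a₃ b := by
  intro n
  induction n using Nat.strong_induction_on with
  | _ n ih =>
  intro p hp hn
  by_cases h0 : Chord.rootEdges p ends a₁ a₂ = ∅
  · rw [Chord.Gc_eq_zero_of_rootEdges_empty h0]
  · obtain ⟨e, he⟩ := Finset.nonempty_iff_ne_empty.2 h0
    have hf := Chord.frac_of_mem_rootEdges he
    have hlt : ((Chord.frac p).erase e).card < n := by
      rw [← hn]
      exact Finset.card_erase_lt_of_mem hf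
    have h1 := ih _ hlt _ (hp.update e zero_le_one le_rfl) (by rw [Chord.frac_update_one hf])
    have h2 := ih _ hlt _ (hp.update e le_rfl zero_le_one) (by rw [Chord.frac_update_zero hf])
    have hle := hmix p hp e he
    exact (add_nonneg (mul_nonneg (hp.nonneg e) h1)
      (mul_nonneg (sub_nonneg.2 (hp.le_one e)) (mul_nonneg (shrink_nonneg hp ends a₁ a₂ a₃ e) h2))).trans hle

/-- **(MIX-CHORD) ⟹ (HCOV)** at every admissible weight vector of the instance. -/
theorem HCov_of_mixChord (ends : E → Sym2 V) (o a₁ a₂ a₃ b : V)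
    (hmix : ∀ q : E → R, IsProbVec q → MixChord q ends o a₁ a₂ a₃ b) (p : E → R)
    (hp : IsProbVec p) : HCov p ends o a₁ a₂ a₃ b :=
  Gc_nonneg_of_mixChord ends o a₁ a₂ a₃ b hmix _ p hp rfl

end Induction

section ChainAll

variable (R : Type*) [Field R] [LinearOrder R] [IsStrictOrderedRing R]

/-- **(MIX-CHORD) on all instances ⟹ the crux `CovForm.HCov_all`.** -/
theorem HCov_all_of_mixChord_all (h : MixChord_all R) : HCov_all R := by
  intro V E _ _ _ _ ends p hp o a₁ a₂ a₃ b h12 h13 h23 ho1 ho2 ho3 hob hb1 hb2 hb3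
  exact HCov_of_mixChord ends o a₁ a₂ a₃ b
    (fun q hq => h V E ends q hq o a₁ a₂ a₃ b h12 h13 h23 ho1 ho2 ho3 hob hb1 hb2 hb3) p hp

end ChainAll

end Mix

end Summit.Ventures.PercRepro2
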